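import Literature.AlgebraicGeometry.Motives.MixedHodgeStructure
import Literature.AlgebraicGeometry.Motives.HodgeStructureProofs
import HarnessLib

/-!
# Deligne's splitting `I^{p,q}` of a mixed Hodge structure

For a mixed `ℚ`-Hodge structure `H` on `V` (`MixedHodgeStructure.lean`) we construct Deligne's
canonical subspaces of `V_ℂ`
`I^{p,q} = (F^p ∩ W_{p+q}) ∩ (conj F^q ∩ W_{p+q} + Σ_{i ≥ 1} conj F^{q-i} ∩ W_{p+q-1-i})`
(Deligne, *Théorie de Hodge II*, 1.2.8/1.2.11; Cattani–El Zein–Griffiths–Lê, *Hodge Theory*,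
(3.2.1) and Prop. 3.2.19) and prove, entirely inside the lattice of `ℂ`-subspaces of `V_ℂ`
(all weight filtration steps complexified, `W_k := (H.W k).baseChange ℂ`):

* `deligneI_inf_W_pred_eq_bot` — `I^{p,q} ∩ W_{p+q-1} = 0` (injectivity of `I^{p,q} → Gr^W_{p+q}`,
  Cattani et al. §3.2.2.4 (i));
* `hodgePreimage_le_deligneI_sup` — `((F^p ∩ W_n) + W_{n-1}) ∩ ((conj F^q ∩ W_n) + W_{n-1}) ⊆
  I^{p,q} + W_{n-1}` for `p + q = n` (surjectivity onto `H^{p,q}(Gr^W_n)`, ibid. (ii));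
* `W_eq_iSup_deligneI_sup` — `W_n = (Σ_p I^{p,n-p}) + W_{n-1}`, and
  `F_inf_W_le` — `F^p ∩ W_n ⊆ (Σ_{i ≥ p} I^{i,n-i}) + W_{n-1}` (from the Hodge decomposition of the
  pure `Gr^W_n`, transported to `V_ℂ`);
* `iSupIndep_deligneI` — for fixed `n` the `I^{p,n-p}` are independent, and
  `iSup_deligneI_inf_W_pred_eq_bot` — `(Σ_p I^{p,n-p}) ∩ W_{n-1} = 0`;
* `Hom.map_deligneI_le` — morphisms of MHS map `I^{p,q}` into `I^{p,q}` (Cattani et al., Remark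
  (ii) after Prop. 3.2.19).

These are the ingredients of Deligne's strictness theorem, proved in
`MixedHodgeStructureStrictProofs.lean`. The statements `W_n = ⊕_{p+q ≤ n} I^{p,q}`,
`F^p = ⊕_{p' ≥ p} I^{p',q}` of Prop. 3.2.19 follow by induction on `n` and are given there in
the form needed.

## References

* [DeligneHodgeII1971] P. Deligne, Théorie de Hodge II, Publ. Math. IHÉS 40 (1971), §1.2
  (Lemme 1.2.8, 1.2.11), Thm. 2.3.5.
* [CattaniElZeinGriffithsLe2014] E. Cattani et al. (eds.), Hodge Theory (2014), §3.2.2.3–3.2.2.4,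
  formula (3.2.1), Prop. 3.2.19 and its proof (pp. 159–160).
-/

open scoped TensorProduct

noncomputable section

namespace Literature.AlgebraicGeometry.Motives

namespace MixedHodgeStructure

universe u v

variable {V : Type u} [AddCommGroup V] [Module ℚ V]
variable {V' : Type v} [AddCommGroup V'] [Module ℚ V']

open HodgeStructure (conj complexConj complexConj_mono complexConj_comap_baseChange)

/-! ### Pulling back along a surjection commutes with suprema -/

/-- For a surjective linear map and a nonempty family, `comap` commutes with `⨆`. [folklore] -/
theorem comap_iSup_of_surjective {R M N : Type*} [Ring R] [AddCommGroup M] [Module R M]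
    [AddCommGroup N] [Module R N] {π : M →ₗ[R] N} (hπ : Function.Surjective π) {ι : Type*}
    [Nonempty ι] (S : ι → Submodule R N) :
    (⨆ i, S i).comap π = ⨆ i, (S i).comap π := by
  refine le_antisymm ?_ (iSup_le fun i => Submodule.comap_mono (le_iSup S i))
  have h : (⨆ i, S i) = (⨆ i, (S i).comap π).map π := by
    rw [Submodule.map_iSup]
    exact iSup_congr fun i => (Submodule.map_comap_eq_of_surjective hπ (S i)).symm
  rw [h, Submodule.comap_map_eq]
  refine sup_le le_rfl ?_
  obtain ⟨i⟩ := ‹Nonempty ι›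
  exact le_iSup_of_le i (Submodule.comap_mono bot_le)

/-! ### Transport from `ℂ ⊗ Gr^W_n` to `V_ℂ` -/

section Transport

variable (H : MixedHodgeStructure V) (n : ℤ)

/-- Transport of a subspace of `ℂ ⊗ Gr^W_n` to `V_ℂ`: pull back along
`π_n : W_{n,ℂ} → ℂ ⊗ Gr^W_n`, push forward along `ι_n : W_{n,ℂ} → V_ℂ`. The result lies between
`W_{n-1,ℂ}` and `W_{n,ℂ}`. [folklore] -/
def grLift (S : Submodule ℂ (ℂ ⊗[ℚ] grW H.W n)) : Submodule ℂ (ℂ ⊗[ℚ] V) :=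
  (S.comap (grProj H.W n)).map (grIncl H.W n)

/-- `grLift` preserves binary meets. [folklore] -/
theorem grLift_inf (S S' : Submodule ℂ (ℂ ⊗[ℚ] grW H.W n)) :
    H.grLift n (S ⊓ S') = H.grLift n S ⊓ H.grLift n S' := by
  rw [grLift, grLift, grLift, Submodule.comap_inf, Submodule.map_inf _ (grIncl_injective H.W n)]

/-- `grLift` preserves suprema of nonempty families. [folklore] -/
theorem grLift_iSup {ι : Type*} [Nonempty ι] (S : ι → Submodule ℂ (ℂ ⊗[ℚ] grW H.W n)) :
    H.grLift n (⨆ i, S i) = ⨆ i, H.grLift n (S i) := by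
  rw [grLift, comap_iSup_of_surjective (grProj_surjective H.W n), Submodule.map_iSup]
  rfl

/-- `grLift ⊥ = W_{n-1,ℂ}`. [folklore] -/
theorem grLift_bot : H.grLift n ⊥ = (H.W (n - 1)).baseChange ℂ := by
  rw [grLift, Submodule.comap_bot, map_grIncl_ker_grProj, inf_pred_eq_of_monotone H.monotone_W]

/-- `grLift ⊤ = W_{n,ℂ}`. [folklore] -/
theorem grLift_top : H.grLift n ⊤ = (H.W n).baseChange ℂ := by
  rw [grLift, Submodule.comap_top, Submodule.map_top, range_grIncl]

/-- `grLift` commutes with complex conjugation. [folklore] -/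
theorem complexConj_grLift (S : Submodule ℂ (ℂ ⊗[ℚ] grW H.W n)) :
    complexConj (H.grLift n S) = H.grLift n (complexConj S) := by
  rw [grLift, grLift, complexConj_map_baseChange, complexConj_comap_baseChange]

/-- `grLift` of the induced filtration: `grLift (F^p Gr^W_n) = (F^p ∩ W_n) + W_{n-1}`. [folklore] -/
theorem grLift_grF (p : ℤ) :
    H.grLift n ((H.gr n).F p) = (H.F p ⊓ (H.W n).baseChange ℂ) ⊔ (H.W (n - 1)).baseChange ℂ := by
  rw [gr_F, grF, grLift, Submodule.comap_map_eq, Submodule.map_sup, Submodule.map_comap_eq,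
    map_grIncl_ker_grProj, inf_pred_eq_of_monotone H.monotone_W, range_grIncl, inf_comm]

/-- The preimage in `V_ℂ` of the Hodge piece `H^{p,q}` of `Gr^W_n` (for `p + q = n`):
`((F^p ∩ W_n) + W_{n-1}) ∩ ((conj F^q ∩ W_n) + W_{n-1})`. [folklore] -/
def hodgePreimage (p q : ℤ) : Submodule ℂ (ℂ ⊗[ℚ] V) :=
  ((H.F p ⊓ (H.W (p + q)).baseChange ℂ) ⊔ (H.W (p + q - 1)).baseChange ℂ) ⊓
    ((complexConj (H.F q) ⊓ (H.W (p + q)).baseChange ℂ) ⊔ (H.W (p + q - 1)).baseChange ℂ)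

/-- `grLift` of the Hodge piece `(Gr^W_n)^{p,n-p}` is `hodgePreimage p (n-p)`. [folklore] -/
theorem grLift_piece (p : ℤ) :
    H.grLift n ((H.gr n).piece p (n - p)) = H.hodgePreimage p (n - p) := by
  rw [HodgeStructure.piece_of_add_eq _ (by omega), grLift_inf, ← complexConj_grLift, grLift_grF,
    grLift_grF, hodgePreimage, HodgeStructure.complexConj_sup, HodgeStructure.complexConj_inf,
    complexConj_baseChange, complexConj_baseChange, show p + (n - p) = n by omega]

/-- `W_{n-1} ⊆ hodgePreimage p q` (`p + q = n`). [folklore] -/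
theorem W_pred_le_hodgePreimage (p q : ℤ) :
    (H.W (p + q - 1)).baseChange ℂ ≤ H.hodgePreimage p q :=
  le_inf le_sup_right le_sup_right

/-- **`Gr^W_n = ⊕ H^{p,n-p}`, transported**: `W_n = Σ_p hodgePreimage p (n-p)`
(from `HodgeStructure.iSup_piece_eq_top_holds` for the pure `Gr^W_n`). [folklore] -/
theorem iSup_hodgePreimage (n : ℤ) :
    ⨆ p, H.hodgePreimage p (n - p) = (H.W n).baseChange ℂ := by
  rw [← grLift_top H n, ← HodgeStructure.iSup_piece_eq_top_holds (H.gr n), grLift_iSup]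
  exact iSup_congr fun p => (grLift_piece H n p).symm

/-- **`F^p Gr^W_n = ⊕_{i ≥ p} H^{i,n-i}`, transported**:
`(F^p ∩ W_n) + W_{n-1} = Σ_{i ≥ p} hodgePreimage i (n-i)`
(from `HodgeStructure.F_eq_iSup_piece_holds`). [folklore] -/
theorem F_inf_W_sup_W_pred_eq (p : ℤ) :
    (H.F p ⊓ (H.W n).baseChange ℂ) ⊔ (H.W (n - 1)).baseChange ℂ =
      ⨆ i : {i : ℤ // p ≤ i}, H.hodgePreimage i (n - i) := by
  rw [← grLift_grF, HodgeStructure.F_eq_iSup_piece_holds (H.gr n) p, iSup_subtype']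
  haveI : Nonempty {i : ℤ // p ≤ i} := ⟨⟨p, le_rfl⟩⟩
  rw [grLift_iSup]
  exact iSup_congr fun i => grLift_piece H n i

/-- **Independence of the `H^{p,n-p}`, transported**: for `a : ℤ`,
`hodgePreimage a (n-a) ∩ Σ_{b ≠ a} hodgePreimage b (n-b) = W_{n-1}`
(from `HodgeStructure.iSupIndep_piece_holds`). [folklore] -/
theorem hodgePreimage_inf_iSup_ne (a : ℤ) :
    H.hodgePreimage a (n - a) ⊓ ⨆ b : {b : ℤ // b ≠ a}, H.hodgePreimage b (n - b) =
      (H.W (n - 1)).baseChange ℂ := by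
  have hind := HodgeStructure.iSupIndep_piece_holds (H.gr n) a
  rw [disjoint_iff, iSup_subtype'] at hind
  haveI : Nonempty {b : ℤ // b ≠ a} := ⟨⟨a + 1, by omega⟩⟩
  rw [← grLift_bot H n, ← hind, grLift_inf, grLift_iSup, grLift_piece]
  congr 1
  exact iSup_congr fun b => (grLift_piece H n b).symm

end Transport

/-! ### Deligne's subspaces `I^{p,q}` -/

section Deligne

variable (H : MixedHodgeStructure V)

/-- The auxiliary sum `K^q_n = (conj F^q ∩ W_n) + Σ_{i ≥ 1} (conj F^{q-i} ∩ W_{n-1-i})` of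
Deligne's formula (Cattani et al., (3.2.1)). [cite: CattaniElZeinGriffithsLe2014, (3.2.1)] -/
def deligneK (q n : ℤ) : Submodule ℂ (ℂ ⊗[ℚ] V) :=
  (complexConj (H.F q) ⊓ (H.W n).baseChange ℂ) ⊔
    ⨆ (i : ℕ) (_ : 1 ≤ i), complexConj (H.F (q - i)) ⊓ (H.W (n - 1 - i)).baseChange ℂ

/-- **Deligne's subspace**
`I^{p,q} = (F^p ∩ W_{p+q}) ∩ (conj F^q ∩ W_{p+q} + Σ_{i ≥ 1} conj F^{q-i} ∩ W_{p+q-1-i})` of `V_ℂ`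
(Deligne, Hodge II, 1.2.8/1.2.11; Cattani–El Zein–Griffiths–Lê, formula (3.2.1)).
[cite: CattaniElZeinGriffithsLe2014, (3.2.1)] -/
def deligneI (p q : ℤ) : Submodule ℂ (ℂ ⊗[ℚ] V) :=
  H.F p ⊓ (H.W (p + q)).baseChange ℂ ⊓ H.deligneK q (p + q)

/-- `I^{p,q} ⊆ F^p`. [folklore] -/
theorem deligneI_le_F (p q : ℤ) : H.deligneI p q ≤ H.F p :=
  inf_le_left.trans inf_le_left

/-- `I^{p,q} ⊆ W_{p+q}`. [folklore] -/
theorem deligneI_le_W (p q : ℤ) : H.deligneI p q ≤ (H.W (p + q)).baseChange ℂ :=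
  inf_le_left.trans inf_le_right

/-- `I^{p,q} ⊆ K^q_{p+q}`. [folklore] -/
theorem deligneI_le_deligneK (p q : ℤ) : H.deligneI p q ≤ H.deligneK q (p + q) :=
  inf_le_right

/-- The complexified weight filtration is increasing. [folklore] -/
theorem baseChange_W_mono {k l : ℤ} (h : k ≤ l) : (H.W k).baseChange ℂ ≤ (H.W l).baseChange ℂ :=
  Submodule.baseChange_mono ℂ (H.monotone_W h)

/-- The conjugate Hodge filtration is decreasing. [folklore] -/
theorem complexConj_F_mono {p p' : ℤ} (h : p ≤ p') : complexConj (H.F p') ≤ complexConj (H.F p) :=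
  complexConj_mono (H.antitone_F h)

/-- `K^q_n ⊆ (conj F^q ∩ W_n) + W_{n-1}`: every further summand lies in `W_{n-2}`. [folklore] -/
theorem deligneK_le (q n : ℤ) :
    H.deligneK q n ≤ (complexConj (H.F q) ⊓ (H.W n).baseChange ℂ) ⊔ (H.W (n - 1)).baseChange ℂ :=
  sup_le le_sup_left (iSup₂_le fun i _ =>
    le_sup_of_le_right (inf_le_right.trans (H.baseChange_W_mono (by omega))))

/-- `I^{p,q} ⊆ hodgePreimage p q` (it maps into the Hodge piece `H^{p,q}` of `Gr^W_{p+q}`).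
[folklore] -/
theorem deligneI_le_hodgePreimage (p q : ℤ) : H.deligneI p q ≤ H.hodgePreimage p q :=
  le_inf (inf_le_left.trans le_sup_left) ((H.deligneI_le_deligneK p q).trans (H.deligneK_le q _))

/-- For `r ≥ 1`: `K^q_n ⊆ conj F^{q-r+1} + W_{n-1-r}` (the summands with `i < r` lie in the first,
those with `i ≥ r` in the second). [folklore] -/
theorem deligneK_le_sup (q n : ℤ) (r : ℕ) (hr : 1 ≤ r) :
    H.deligneK q n ≤ complexConj (H.F (q - r + 1)) ⊔ (H.W (n - 1 - r)).baseChange ℂ := by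
  refine sup_le (le_sup_of_le_left (inf_le_left.trans (H.complexConj_F_mono (by omega))))
    (iSup₂_le fun i _ => ?_)
  rcases lt_or_ge i r with h | h
  · exact le_sup_of_le_left (inf_le_left.trans (H.complexConj_F_mono (by omega)))
  · exact le_sup_of_le_right (inf_le_right.trans (H.baseChange_W_mono (by omega)))

/-- **Injectivity of `I^{p,q} → Gr^W_{p+q}`**: `I^{p,q} ∩ W_{p+q-1} = 0` (Cattani et al.,
§3.2.2.4 (i): an element of the intersection lies in `W_{n-r}` for every `r`, by the opposedness of
`F^p` and `conj F^{q-r+1}` on `Gr^W_{n-r}`). [cite: CattaniElZeinGriffithsLe2014, Prop. 3.2.19] -/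
theorem deligneI_inf_W_pred_eq_bot (p q : ℤ) :
    H.deligneI p q ⊓ (H.W (p + q - 1)).baseChange ℂ = ⊥ := by
  rw [eq_bot_iff]
  rintro v ⟨hvI, hvW⟩
  -- `v ∈ W_{n-r}` for every `r ≥ 1`
  have key : ∀ r : ℕ, 1 ≤ r → v ∈ (H.W (p + q - r)).baseChange ℂ := by
    intro r hr
    induction r, hr using Nat.le_induction with
    | base => simpa using hvW
    | succ r hr ih =>
      have hvK : v ∈ complexConj (H.F (q - r + 1)) ⊔ (H.W (p + q - 1 - r)).baseChange ℂ :=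
        H.deligneK_le_sup q (p + q) r hr (H.deligneI_le_deligneK p q hvI)
      obtain ⟨g, hg, w, hw, rfl⟩ := Submodule.mem_sup.1 hvK
      have hgW : g ∈ (H.W (p + q - r)).baseChange ℂ := by
        have : g + w - w ∈ (H.W (p + q - r)).baseChange ℂ :=
          Submodule.sub_mem _ ih (H.baseChange_W_mono (by omega) hw)
        simpa using this
      have h1 : g + w ∈ (H.F p ⊓ (H.W (p + q - r)).baseChange ℂ) ⊔
          (H.W (p + q - r - 1)).baseChange ℂ :=
        Submodule.mem_sup_left ⟨H.deligneI_le_F p q hvI, ih⟩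
      have h2 : g + w ∈ (complexConj (H.F (q - r + 1)) ⊓ (H.W (p + q - r)).baseChange ℂ) ⊔
          (H.W (p + q - r - 1)).baseChange ℂ :=
        Submodule.add_mem_sup ⟨hg, hgW⟩ (by convert hw using 2; ring_nf)
      have h3 := (H.grOpposed (p + q - r) p (q - r + 1) (by omega)).1
      have : g + w ∈ (H.W (p + q - r - 1)).baseChange ℂ := by
        rw [← h3]
        exact ⟨h1, h2⟩
      convert this using 2
      push_cast
      ring
  obtain ⟨b, hb⟩ := H.exists_W_eq_bot
  have hr : 1 ≤ (p + q - b).toNat + 1 := by omega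
  have := key _ hr
  have hle : p + q - ((p + q - b).toNat + 1 : ℕ) ≤ b := by push_cast; omega
  have hbot : (H.W (p + q - ((p + q - b).toNat + 1 : ℕ))).baseChange ℂ = ⊥ := by
    have hW : H.W (p + q - ((p + q - b).toNat + 1 : ℕ)) = ⊥ := eq_bot_iff.2 (hb ▸ H.monotone_W hle)
    rw [hW, Submodule.baseChange_bot]
  rw [hbot, Submodule.mem_bot] at this
  exact this

/-- The truncations `T_k = (conj F^q ∩ W_n) + Σ_{1 ≤ i ≤ k} (conj F^{q-i} ∩ W_{n-1-i})` of
`K^q_n`, through which the inductive construction of Cattani et al., §3.2.2.4 (ii) runs.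
[folklore] -/
def deligneT (q n : ℤ) (k : ℕ) : Submodule ℂ (ℂ ⊗[ℚ] V) :=
  (complexConj (H.F q) ⊓ (H.W n).baseChange ℂ) ⊔
    ⨆ (i : ℕ) (_ : 1 ≤ i ∧ i ≤ k), complexConj (H.F (q - i)) ⊓ (H.W (n - 1 - i)).baseChange ℂ

/-- `T_k ⊆ T_{k'}` for `k ≤ k'`. [folklore] -/
theorem deligneT_mono (q n : ℤ) {k k' : ℕ} (h : k ≤ k') : H.deligneT q n k ≤ H.deligneT q n k' := by
  unfold deligneT
  exact sup_le_sup_left (biSup_mono fun i hi => ⟨hi.1, hi.2.trans h⟩) _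

/-- `T_k ⊆ K^q_n`. [folklore] -/
theorem deligneT_le_deligneK (q n : ℤ) (k : ℕ) : H.deligneT q n k ≤ H.deligneK q n := by
  unfold deligneT deligneK
  exact sup_le_sup_left (biSup_mono fun i hi => hi.1) _

/-- `conj F^q ∩ W_n ⊆ T_k`. [folklore] -/
theorem inf_le_deligneT (q n : ℤ) (k : ℕ) :
    complexConj (H.F q) ⊓ (H.W n).baseChange ℂ ≤ H.deligneT q n k :=
  le_sup_left

/-- For `k ≥ 1`, the summand `conj F^{q-k} ∩ W_{n-1-k}` lies in `T_k`. [folklore] -/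
theorem inf_le_deligneT_of_le (q n : ℤ) {k : ℕ} (hk : 1 ≤ k) :
    complexConj (H.F (q - k)) ⊓ (H.W (n - 1 - k)).baseChange ℂ ≤ H.deligneT q n k := by
  unfold deligneT
  exact le_sup_of_le_right
    (le_biSup (fun i : ℕ => complexConj (H.F (q - i)) ⊓ (H.W (n - 1 - i)).baseChange ℂ)
      ⟨hk, le_rfl⟩)

/-- The inductive step of Cattani et al., §3.2.2.4 (ii): every element of `hodgePreimage p q`
is congruent modulo `W_{n-1}` (`n = p + q`) to some `v ∈ F^p ∩ W_n` with
`v ∈ T_{k-1} + W_{n-1-k}`. [folklore] -/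
theorem exists_repr_mod_W (p q : ℤ) (k : ℕ) :
    ∀ x ∈ H.hodgePreimage p q, ∃ v, v ∈ H.F p ⊓ (H.W (p + q)).baseChange ℂ ∧
      v ∈ H.deligneT q (p + q) (k - 1) ⊔ (H.W (p + q - 1 - k)).baseChange ℂ ∧
      x - v ∈ (H.W (p + q - 1)).baseChange ℂ := by
  induction k with
  | zero =>
    rintro x ⟨hx1, hx2⟩
    obtain ⟨a, ha, w, hw, rfl⟩ := Submodule.mem_sup.1 hx1
    obtain ⟨b, hb, w', hw', he⟩ := Submodule.mem_sup.1 hx2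
    refine ⟨a, ha, ?_, by simpa using hw⟩
    have hab : a = b + (w' - w) := by rw [← add_sub_assoc, he, add_sub_cancel_right]
    rw [hab, Nat.zero_sub, Nat.cast_zero, sub_zero]
    exact Submodule.add_mem_sup (H.inf_le_deligneT q _ 0 hb) (Submodule.sub_mem _ hw' hw)
  | succ k ih =>
    intro x hx
    obtain ⟨v, hv, hvT, hxv⟩ := ih x hx
    obtain ⟨t, ht, w, hw, rfl⟩ := Submodule.mem_sup.1 hvT
    -- decompose `w ∈ W_{n-1-k}` by opposedness on `Gr^W_{n-1-k}` at `(p, q-k)`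
    have h2 := (H.grOpposed (p + q - 1 - k) p (q - k) (by omega)).2
    rw [← h2] at hw
    obtain ⟨vu, hvu, w', hw', rfl⟩ := Submodule.mem_sup.1 hw
    obtain ⟨v', hv', u', hu', rfl⟩ := Submodule.mem_sup.1 hvu
    refine ⟨t + (v' + u' + w') - v', ⟨?_, ?_⟩, ?_, ?_⟩
    · exact (H.F p).sub_mem hv.1 hv'.1
    · exact Submodule.sub_mem _ hv.2 (H.baseChange_W_mono (by omega) hv'.2)
    · have he : t + (v' + u' + w') - v' = (t + u') + w' := by abel
      rw [he]
      refine Submodule.add_mem_sup (Submodule.add_mem _ ?_ ?_) ?_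
      · exact H.deligneT_mono q _ (Nat.sub_le k 1) ht
      · rcases Nat.eq_zero_or_pos k with rfl | hk
        · refine H.inf_le_deligneT q _ _ ⟨?_, H.baseChange_W_mono (by omega) hu'.2⟩
          simpa using hu'.1
        · have := H.inf_le_deligneT_of_le q (p + q) (k := k) hk
          rw [Nat.add_sub_cancel]
          exact this hu'
      · convert hw' using 3
        push_cast
        ring
    · have he : x - (t + (v' + u' + w') - v') = (x - (t + (v' + u' + w'))) + v' := by abel
      rw [he]
      exact Submodule.add_mem _ hxv (H.baseChange_W_mono (by omega) hv'.2)

/-- **Surjectivity of `I^{p,q} → H^{p,q}(Gr^W_n)`** (`n = p + q`):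
`hodgePreimage p q ⊆ I^{p,q} + W_{n-1}` (Cattani et al., §3.2.2.4 (ii): iterate
`exists_repr_mod_W` until `W_{n-1-k} = 0`). [cite: CattaniElZeinGriffithsLe2014, Prop. 3.2.19] -/
theorem hodgePreimage_le_deligneI_sup (p q : ℤ) :
    H.hodgePreimage p q ≤ H.deligneI p q ⊔ (H.W (p + q - 1)).baseChange ℂ := by
  intro x hx
  obtain ⟨b, hb⟩ := H.exists_W_eq_bot
  obtain ⟨v, hv, hvT, hxv⟩ := H.exists_repr_mod_W p q (p + q - 1 - b).toNat x hx
  have hbot : (H.W (p + q - 1 - ((p + q - 1 - b).toNat : ℕ))).baseChange ℂ = ⊥ := by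
    have hW : H.W (p + q - 1 - ((p + q - 1 - b).toNat : ℕ)) = ⊥ :=
      eq_bot_iff.2 (hb ▸ H.monotone_W (by omega))
    rw [hW, Submodule.baseChange_bot]
  rw [hbot, sup_bot_eq] at hvT
  have hvI : v ∈ H.deligneI p q := ⟨hv, H.deligneT_le_deligneK q _ _ hvT⟩
  have hx' : x = v + (x - v) := by abel
  rw [hx']
  exact Submodule.add_mem_sup hvI hxv

/-! ### Consequences on each weight level -/

/-- **`W_n = (Σ_p I^{p,n-p}) + W_{n-1}`** (Cattani et al., Prop. 3.2.19:
`W_n = W_{n-1} ⊕ ⊕_{p+q=n} I^{p,q}`). [cite: CattaniElZeinGriffithsLe2014, Prop. 3.2.19] -/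
theorem W_eq_iSup_deligneI_sup (n : ℤ) :
    (H.W n).baseChange ℂ = (⨆ p, H.deligneI p (n - p)) ⊔ (H.W (n - 1)).baseChange ℂ := by
  apply le_antisymm
  · rw [← H.iSup_hodgePreimage n, iSup_sup]
    exact iSup_mono fun p => by
      simpa [show p + (n - p) - 1 = n - 1 by omega] using H.hodgePreimage_le_deligneI_sup p (n - p)
  · exact sup_le (iSup_le fun p => (H.deligneI_le_W p (n - p)).trans (by rw [add_sub_cancel]))
      (H.baseChange_W_mono (by omega))

/-- **`F^p ∩ W_n ⊆ (Σ_{i ≥ p} I^{i,n-i}) + W_{n-1}`** (Cattani et al., proof of Prop. 3.2.19,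
last paragraph: the image of `v ∈ F^p ∩ W_n` in `Gr^W_n` has Hodge components of type `(i, n-i)`,
`i ≥ p` only). [cite: CattaniElZeinGriffithsLe2014, Prop. 3.2.19] -/
theorem F_inf_W_le (p n : ℤ) :
    H.F p ⊓ (H.W n).baseChange ℂ ≤
      (⨆ i : {i : ℤ // p ≤ i}, H.deligneI i (n - i)) ⊔ (H.W (n - 1)).baseChange ℂ := by
  haveI : Nonempty {i : ℤ // p ≤ i} := ⟨⟨p, le_rfl⟩⟩
  calc H.F p ⊓ (H.W n).baseChange ℂ
      ≤ (H.F p ⊓ (H.W n).baseChange ℂ) ⊔ (H.W (n - 1)).baseChange ℂ := le_sup_left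
    _ = ⨆ i : {i : ℤ // p ≤ i}, H.hodgePreimage i (n - i) := H.F_inf_W_sup_W_pred_eq n p
    _ ≤ ⨆ i : {i : ℤ // p ≤ i}, (H.deligneI i (n - i) ⊔ (H.W (n - 1)).baseChange ℂ) :=
        iSup_mono fun i => by
          simpa [show (i : ℤ) + (n - i) - 1 = n - 1 by omega] using
            H.hodgePreimage_le_deligneI_sup i (n - i)
    _ = (⨆ i : {i : ℤ // p ≤ i}, H.deligneI i (n - i)) ⊔ (H.W (n - 1)).baseChange ℂ := by
        rw [iSup_sup]

/-- **Independence of the `I^{p,n-p}` for fixed `n`** (Cattani et al., Prop. 3.2.19: the sum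
`⊕_{p+q=n} I^{p,q}` is direct, the `I^{p,q}` mapping isomorphically onto the independent
`H^{p,q}`). [cite: CattaniElZeinGriffithsLe2014, Prop. 3.2.19] -/
theorem iSupIndep_deligneI (n : ℤ) : iSupIndep fun p => H.deligneI p (n - p) := by
  rw [iSupIndep_def]
  intro a
  rw [disjoint_iff, eq_bot_iff]
  have h1 : H.deligneI a (n - a) ⊓ (⨆ (j : ℤ) (_ : j ≠ a), H.deligneI j (n - j)) ≤
      H.hodgePreimage a (n - a) ⊓ ⨆ b : {b : ℤ // b ≠ a}, H.hodgePreimage b (n - b) :=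
    inf_le_inf (H.deligneI_le_hodgePreimage a (n - a)) (iSup₂_le fun j hj =>
      le_iSup_of_le ⟨j, hj⟩ (H.deligneI_le_hodgePreimage j (n - j)))
  rw [H.hodgePreimage_inf_iSup_ne n a] at h1
  have h2 := H.deligneI_inf_W_pred_eq_bot a (n - a)
  rw [show a + (n - a) - 1 = n - 1 by omega] at h2
  rw [← h2]
  exact le_inf inf_le_left h1

/-- Finite version of `iSup_deligneI_inf_W_pred_eq_bot`. [folklore] -/
theorem biSup_deligneI_inf_W_pred_eq_bot (n : ℤ) (s : Finset ℤ) :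
    (⨆ p ∈ s, H.deligneI p (n - p)) ⊓ (H.W (n - 1)).baseChange ℂ = ⊥ := by
  classical
  induction s using Finset.induction_on with
  | empty => simp
  | insert a s has ih =>
    rw [Finset.iSup_insert, eq_bot_iff]
    rintro y ⟨hy, hyW⟩
    obtain ⟨i, hi, j, hj, rfl⟩ := Submodule.mem_sup.1 hy
    -- `i = (i + j) - j ∈ I^{a} ∩ (W_{n-1} + Σ_{s} I^{b}) ⊆ P_a ∩ Σ_{b ≠ a} P_b = W_{n-1}`
    have hiW : i ∈ (H.W (n - 1)).baseChange ℂ := by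
      have hmem : i ∈ H.hodgePreimage a (n - a) ⊓
          ⨆ b : {b : ℤ // b ≠ a}, H.hodgePreimage b (n - b) := by
        refine ⟨H.deligneI_le_hodgePreimage a (n - a) hi, ?_⟩
        have : i = (i + j) - j := by abel
        rw [this]
        refine Submodule.sub_mem _ ?_ ?_
        · have hle : (H.W (n - 1)).baseChange ℂ ≤
              ⨆ b : {b : ℤ // b ≠ a}, H.hodgePreimage b (n - b) :=
            le_iSup_of_le ⟨a + 1, by omega⟩ (by
              simpa [show a + 1 + (n - (a + 1)) - 1 = n - 1 by omega] using
                H.W_pred_le_hodgePreimage (a + 1) (n - (a + 1)))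
          exact hle hyW
        · have hle : (⨆ p ∈ s, H.deligneI p (n - p)) ≤
              ⨆ b : {b : ℤ // b ≠ a}, H.hodgePreimage b (n - b) :=
            iSup₂_le fun b hb =>
              le_iSup_of_le ⟨b, fun h => has (h ▸ hb)⟩ (H.deligneI_le_hodgePreimage b (n - b))
          exact hle hj
      rw [H.hodgePreimage_inf_iSup_ne n a] at hmem
      exact hmem
    have hi0 : i = 0 := by
      have : i ∈ H.deligneI a (n - a) ⊓ (H.W (a + (n - a) - 1)).baseChange ℂ :=
        ⟨hi, by rwa [show a + (n - a) - 1 = n - 1 by omega]⟩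
      rwa [H.deligneI_inf_W_pred_eq_bot, Submodule.mem_bot] at this
    rw [hi0, zero_add] at hyW ⊢
    have : j ∈ (⨆ p ∈ s, H.deligneI p (n - p)) ⊓ (H.W (n - 1)).baseChange ℂ := ⟨hj, hyW⟩
    rwa [ih] at this

/-- **`(Σ_p I^{p,n-p}) ∩ W_{n-1} = 0`**: the direct sum `⊕_{p+q=n} I^{p,q}` meets `W_{n-1}`
trivially (Cattani et al., Prop. 3.2.19: `W_n = W_{n-1} ⊕ ⊕ I^{p,q}`). [cite: CattaniElZeinGriffithsLe2014, Prop. 3.2.19] -/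
theorem iSup_deligneI_inf_W_pred_eq_bot (n : ℤ) :
    (⨆ p, H.deligneI p (n - p)) ⊓ (H.W (n - 1)).baseChange ℂ = ⊥ := by
  rw [eq_bot_iff]
  rintro x ⟨hx, hxW⟩
  obtain ⟨s, hs⟩ := Submodule.mem_iSup_iff_exists_finset.1 hx
  have : x ∈ (⨆ p ∈ s, H.deligneI p (n - p)) ⊓ (H.W (n - 1)).baseChange ℂ := ⟨hs, hxW⟩
  rwa [H.biSup_deligneI_inf_W_pred_eq_bot n s] at this

end Deligne

/-! ### Functoriality -/

/-- **Morphisms of mixed Hodge structures preserve Deligne's subspaces**: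
`f_ℂ(I^{p,q}(H₁)) ⊆ I^{p,q}(H₂)` (Cattani et al., Remark (ii) after Prop. 3.2.19: "a morphism of
MHS is necessarily compatible with this decomposition"), since `f_ℂ` maps `F^p`, `conj F^q` and
`W_k` into the corresponding subspaces. [cite: CattaniElZeinGriffithsLe2014, Prop. 3.2.19] -/
theorem Hom.map_deligneI_le {H₁ : MixedHodgeStructure V} {H₂ : MixedHodgeStructure V'}
    (f : Hom H₁ H₂) (p q : ℤ) :
    (H₁.deligneI p q).map (f.toLinearMap.baseChange ℂ) ≤ H₂.deligneI p q := by
  have hF := f.map_F_le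
  have hG := f.map_complexConj_F_le
  have hW := f.map_baseChange_W_le
  refine le_inf (le_inf ((Submodule.map_mono (H₁.deligneI_le_F p q)).trans (hF p))
    ((Submodule.map_mono (H₁.deligneI_le_W p q)).trans (hW _))) ?_
  refine (Submodule.map_mono (H₁.deligneI_le_deligneK p q)).trans ?_
  rw [deligneK, deligneK, Submodule.map_sup]
  refine sup_le_sup ((Submodule.map_inf_le _).trans (inf_le_inf (hG q) (hW _))) ?_
  rw [Submodule.map_iSup]
  refine iSup_mono fun i => ?_
  rw [Submodule.map_iSup]
  exact iSup_mono fun _ => (Submodule.map_inf_le _).trans (inf_le_inf (hG _) (hW _))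

end MixedHodgeStructure

end Literature.AlgebraicGeometry.Motives

end
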